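import Mathlib
import Literature.MathematicalPhysics.QuantumFieldTheory.Balaban1983to89.TorusGeometry
import Summits.QuantumFields.Balaban3D.Carriers.Histories

/-!
# `Summit.QuantumFields.Balaban3D.Proofs.HistCount` — lane «pub-balaban3d» (Bałaban, CMP **102** (1985) 255–275, d = 3 lattice UV
# stability AS PRINTED), prover seat p2: the CANDIDATE COUNT of the large-field resummation (`B10LargeFieldSum.HistModel.card_E`)
# on seat p1's history carrier `Carriers.Histories`

HONEST FRAMING (lane PLAN.md §0).  Nothing of [B10] = [Balaban1985UV3] is asserted.  The large-field resummation of pp. 273–274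
(LQB `B10LargeFieldSum.largeFieldControl_of_resummation`, knitted in `…Proofs.LargeFieldKnit`) sums over candidate large-field
plaquettes `(j, p′)`, `j < k`, and needs their number per scale: «≤ 3·e^{σ(k−j)}·|T₁^{(k)}|» with `σ = 3 log L` (field `card_E`).
On p1's carrier (`Carriers.Hist P k = (j : Fin k) → Finset (Plaq P j)`, candidates `allCodes P k`, codes `plaqCode`) this is the
LATTICE COUNT «number of plaquettes of T^{(j)} = 3·|T^{(j)}| = 3·L^{3(k−j)}·|T^{(k)}|» (d = 3: three orientations `μ < ν` per
site; `|T^{(j)}| = (2L^{m+K−j})³`, LQB `TorusGeometry.Site.card_site`).  Pure combinatorics of `Setup`'s tori.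
* `filter_allCodes_eq`, `card_filter_allCodes` — the scale-`j` slice of `allCodes P k` is (a tagged copy of) `Plaq P j`;
* `card_plaq_eq` — `|Plaq P j| = |{(μ, ν) : μ < ν}|·|Site P j|`; `card_pairs_lt_of_d_eq_three` — `= 3` for `d = 3`;
* `card_site_scale` — `|Site P j| = L^{d(k−j)}·|Site P k|` for `j ≤ k ≤ m + K`;
* `card_filter_allCodes_le_exp` — the `card_E` inequality with `σ = 3 log L` against `|Site P k|` (as a real), for `d = 3`.
-/

namespace Summit.QuantumFields.Balaban3D.Proofs.HistCount

open Literature.MathematicalPhysics.QuantumFieldTheory.Balaban1983to89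
open Summit.QuantumFields.Balaban3D.Carriers
open Finset

variable {P : Params}

/-! ## §1 The scale-`j` slice of the candidate set -/

/-- The scale-`j` slice of `allCodes P k` is the tagged image of all plaquettes of `T^{(j)}` (`j < k`). [folklore] -/
theorem filter_allCodes_eq (k : ℕ) (j : Fin k) :
    (allCodes P k).filter (fun e => e.1 = (j : ℕ)) =
      (Finset.univ : Finset (Plaq P j)).image (fun p => ((j : ℕ), plaqCode p)) := by
  classical
  ext e
  simp only [allCodes, Hist.mem_disc, Finset.mem_filter, Finset.mem_image, Finset.mem_univ, true_and]
  constructor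
  · rintro ⟨⟨i, p, rfl⟩, hij⟩
    have hi : i = j := Fin.ext hij
    subst hi
    exact ⟨p, rfl⟩
  · rintro ⟨p, rfl⟩
    exact ⟨⟨j, p, rfl⟩, rfl⟩

/-- Hence its cardinality is the number of plaquettes of `T^{(j)}`. [folklore] -/
theorem card_filter_allCodes (k : ℕ) (j : Fin k) :
    ((allCodes P k).filter (fun e => e.1 = (j : ℕ))).card = Fintype.card (Plaq P j) := by
  classical
  rw [filter_allCodes_eq, Finset.card_image_of_injective, Finset.card_univ]
  intro p q h
  simp only [Prod.mk.injEq, true_and] at h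
  exact plaqCode_injective _ h

/-! ## §2 Counting plaquettes and sites of `Setup`'s tori -/

/-- `|Plaq P j| = |{(μ, ν) : μ < ν}|·|Site P j|` (a plaquette = base point + ordered pair of directions `μ < ν`). [folklore] -/
theorem card_plaq_eq (P : Params) (j : ℕ) :
    Fintype.card (Plaq P j) = Fintype.card {q : Fin P.d × Fin P.d // q.1 < q.2} * Fintype.card (Site P j) := by
  classical
  let e : Plaq P j ≃ {q : Fin P.d × Fin P.d // q.1 < q.2} × Site P j :=
    { toFun := fun p => (⟨(p.μ, p.ν), p.hμν⟩, p.src)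
      invFun := fun s => ⟨s.2, s.1.1.1, s.1.1.2, s.1.2⟩
      left_inv := fun p => by cases p; rfl
      right_inv := fun s => by rcases s with ⟨⟨⟨μ, ν⟩, h⟩, x⟩; rfl }
  rw [Fintype.card_congr e, Fintype.card_prod]

/-- In `d = 3` there are exactly three orientations `μ < ν`. [folklore] -/
theorem card_pairs_lt_of_d_eq_three (hd : P.d = 3) : Fintype.card {q : Fin P.d × Fin P.d // q.1 < q.2} = 3 := by
  classical
  let e : {q : Fin P.d × Fin P.d // q.1 < q.2} ≃ {q : Fin 3 × Fin 3 // q.1 < q.2} :=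
    Equiv.subtypeEquiv ((finCongr hd).prodCongr (finCongr hd)) (by
      rintro ⟨a, b⟩
      simp only [Equiv.prodCongr_apply, Prod.map, finCongr_apply]
      exact Iff.rfl)
  rw [Fintype.card_congr e]
  decide

/-- `|Site P j| = L^{d(k−j)}·|Site P k|` for `j ≤ k ≤ m + K` (iterate `TorusGeometry.Site.card_site_eq_mul_succ`). [folklore] -/
theorem card_site_scale {j k : ℕ} (hjk : j ≤ k) (hk : k ≤ P.m + P.K) :
    Fintype.card (Site P j) = P.L ^ (P.d * (k - j)) * Fintype.card (Site P k) := by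
  obtain ⟨m, rfl⟩ := Nat.exists_eq_add_of_le hjk
  induction m with
  | zero => simp
  | succ m ih =>
    have hk' : j + m ≤ P.m + P.K := by omega
    rw [ih (by omega) hk', Site.card_site_eq_mul_succ (by omega : j + m + 1 ≤ P.m + P.K)]
    rw [show j + (m + 1) - j = (j + m - j) + 1 by omega, Nat.mul_succ, pow_add]
    ring

/-! ## §3 The `card_E` inequality of `B10LargeFieldSum.HistModel` on p1's carrier (d = 3, σ = 3 log L) -/

/-- **The candidate count per scale** («≤ 3·e^{σ(k−j)}·|T₁^{(k)}|», `σ = 3 log L`, the field `card_E` of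
`B10LargeFieldSum.HistModel`): for `d = 3` and `j < k ≤ m + K`, the number of scale-`j` candidates `(j, p′)` in `allCodes P k`
is EXACTLY `3·L^{3(k−j)}·|Site P k| = 3·e^{3 log L·(k−j)}·|Site P k|`.  (With p3's `S.sites k = |Site S.P k|` this is `card_E` for
the lane's run; stated here against `|Site P k|`.) [cite: Balaban1985UV3, p.256 (|T₁^{(k)}| = (L^kε)^{−3}|T_ε|)] -/
theorem card_filter_allCodes_le_exp (hd : P.d = 3) {k j : ℕ} (hjk : j < k) (hk : k ≤ P.m + P.K) :
    (((allCodes P k).filter (fun e => e.1 = j)).card : ℝ) ≤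
      3 * Real.exp (3 * Real.log P.L * ((k - j : ℕ) : ℝ)) * (Fintype.card (Site P k) : ℝ) := by
  have hL : (0 : ℝ) < P.L := by exact_mod_cast P.L_pos
  have hcount : ((allCodes P k).filter (fun e => e.1 = j)).card = 3 * (P.L ^ (3 * (k - j)) * Fintype.card (Site P k)) := by
    rw [card_filter_allCodes k ⟨j, hjk⟩, card_plaq_eq, card_pairs_lt_of_d_eq_three hd]
    show 3 * Fintype.card (Site P j) = _
    rw [card_site_scale hjk.le hk, hd]
  have hexp : Real.exp (3 * Real.log P.L * ((k - j : ℕ) : ℝ)) = (P.L : ℝ) ^ (3 * (k - j)) := by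
    rw [← Real.exp_log (pow_pos hL (3 * (k - j))), Real.log_pow]
    congr 1
    push_cast
    ring
  rw [hexp, hcount]
  push_cast
  exact le_of_eq (by ring)

end Summit.QuantumFields.Balaban3D.Proofs.HistCount
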